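import Summits.CriticalPhenomena.CardyFormulaZ2.Theorems.CardyComplexConeParafermionToSLESixFamiliesIicDefs
import HarnessLib

/-!
# Chordal uniformizers near a boundary point off the marks: bounded, bounded below, `Im φ⁻¹ → 0`
(line `flip-involution-return-law` of crux `CardyComplexCone.ParafermionToSLESixFamilies`, stmt-CriticalPhenomena-11389;
first file towards input (0) of the stub `stub_touchLawDiag`: EXISTENCE of the covariant touch density
`HasTouchDensityAt` on flat free windows)

Let `φ : ℍₒ → D` be a chordal uniformizing map of the Dobrushin domain `(D; a, b)` (`0 ↦ a = D.pt 0`,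
`∞ ↦ b = D.pt 1` as boundary values) and `ψ = φ⁻¹ : D → ℍₒ`. At a boundary point `y ∉ D` of `D`:

* `norm_symm_le_near` — if `y ≠ b`, `ψ` is BOUNDED near `y` inside `D` (otherwise `ψ zₙ → ∞` along
  `zₙ → y`, and the boundary value of `φ` at `∞` forces `zₙ = φ(ψ zₙ) → b`);
* `le_norm_symm_near` — if `y ≠ a`, `ψ` is BOUNDED BELOW near `y` (same argument with the boundary value at `0`);
* `tendsto_im_symm_zero` — if `y ≠ b`, `Im ψ z → 0` as `z → y` inside `D`: a bounded sequence `ψ zₙ` with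
  `Im ψ zₙ ≥ ε` has a limit point `w ∈ ℍₒ`, and then `zₙ = φ(ψ zₙ) → φ w ∈ D`, contradicting `y ∉ D`
  (properness of the homeomorphism `φ`).

These are the topological inputs of the Schwarz reflection of `ψ` across a flat boundary segment
(next file). Elementary; Pommerenke, *Boundary Behaviour of Conformal Maps* (1992), §2.1.
-/

noncomputable section

namespace Summit.CriticalPhenomena.CardyFormulaZ2.Cruxes.ParafermionToSLESixFamilies.FlipInvolutionReturnLaw

open Filter Set Metric
open scoped Topology
open UpperHalfPlane (upperHalfPlaneSet)
open Literature.Probability.RandomPlanarGeometry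

variable {D : DobrushinDomain} {φ : ConformalEquiv upperHalfPlaneSet D.carrier}

/-- Points of `D` near a boundary point are sent by `ψ = φ⁻¹` into `ℍₒ`. -/
theorem symm_mem_upperHalfPlaneSet (φ : ConformalEquiv upperHalfPlaneSet D.carrier) {z : ℂ} (hz : z ∈ D.carrier) :
    φ.symm z ∈ upperHalfPlaneSet :=
  φ.symm_mapsTo hz

/-- **`ψ` is bounded near a boundary point other than `b`.** If `φ` has boundary value `D.pt 1` at `∞`
and `y ≠ D.pt 1`, then `‖φ⁻¹ z‖ ≤ R` for `z ∈ D` near `y`, for some `R`. -/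
theorem norm_symm_le_near (hφ : D.IsChordalUniformizing φ) {y : ℂ} (hy : y ≠ D.pt 1) :
    ∃ R : ℝ, ∀ᶠ z in 𝓝[D.carrier] y, ‖φ.symm z‖ ≤ R := by
  by_contra hcon
  push Not at hcon
  -- `ψ` is unbounded along `𝓝[D] y`: the preimages under `ψ` of the complements of closed balls are frequent
  have hfreq : ∀ R : ℝ, ∃ᶠ z in 𝓝[D.carrier] y, R < ‖φ.symm z‖ := hcon
  -- the boundary value of `φ` at `∞`: a neighbourhood `W` of `pt 1` missing a neighbourhood of `y`
  obtain ⟨W, Wy, hW, hWy, hdisj⟩ := t2_separation_nhds hy.symm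
  have hbv : Tendsto φ (cocompact ℂ ⊓ 𝓟 upperHalfPlaneSet) (𝓝 (D.pt 1)) := hφ.2
  have hpre : φ ⁻¹' W ∈ cocompact ℂ ⊓ 𝓟 upperHalfPlaneSet := hbv hW
  rw [Filter.mem_inf_principal] at hpre
  obtain ⟨K, hK, hKsub⟩ := Filter.mem_cocompact.1 hpre
  obtain ⟨R, hR⟩ := hK.isBounded.subset_closedBall 0
  -- frequently near `y`: `z ∈ Wy`, `z ∈ D`, `‖ψ z‖ > R`, hence `ψ z ∉ K`, hence `z = φ (ψ z) ∈ W` — contradiction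
  have hev : ∀ᶠ z in 𝓝[D.carrier] y, z ∈ Wy ∧ z ∈ D.carrier :=
    (eventually_nhdsWithin_of_eventually_nhds (hWy)).and eventually_mem_nhdsWithin
  obtain ⟨z, ⟨hzWy, hzD⟩, hzR⟩ := (hev.and_frequently (hfreq R)).exists
  have hψK : φ.symm z ∉ K := fun h => by
    have := hR h
    rw [mem_closedBall, dist_zero_right] at this
    exact absurd this (not_le.2 hzR)
  have hzW : z ∈ W := by
    have h1 : φ.symm z ∈ φ ⁻¹' W := hKsub hψK (symm_mem_upperHalfPlaneSet φ hzD)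
    rw [mem_preimage, φ.apply_symm_apply hzD] at h1
    exact h1
  exact Set.disjoint_left.1 hdisj hzW hzWy

/-- **`ψ` is bounded below near a boundary point other than `a`.** If `φ` has boundary value `D.pt 0` at
`0` and `y ≠ D.pt 0`, then `r ≤ ‖φ⁻¹ z‖` for `z ∈ D` near `y`, for some `r > 0`. -/
theorem le_norm_symm_near (hφ : D.IsChordalUniformizing φ) {y : ℂ} (hy : y ≠ D.pt 0) :
    ∃ r : ℝ, 0 < r ∧ ∀ᶠ z in 𝓝[D.carrier] y, r ≤ ‖φ.symm z‖ := by
  by_contra hcon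
  push Not at hcon
  have hfreq : ∀ r : ℝ, 0 < r → ∃ᶠ z in 𝓝[D.carrier] y, ‖φ.symm z‖ < r := hcon
  obtain ⟨W, Wy, hW, hWy, hdisj⟩ := t2_separation_nhds hy.symm
  have hbv : Tendsto φ (𝓝[upperHalfPlaneSet] 0) (𝓝 (D.pt 0)) := hφ.1
  have hpre : φ ⁻¹' W ∈ 𝓝[upperHalfPlaneSet] 0 := hbv hW
  obtain ⟨r, hr, hrsub⟩ := Metric.mem_nhdsWithin_iff.1 hpre
  have hev : ∀ᶠ z in 𝓝[D.carrier] y, z ∈ Wy ∧ z ∈ D.carrier :=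
    (eventually_nhdsWithin_of_eventually_nhds (hWy)).and eventually_mem_nhdsWithin
  obtain ⟨z, ⟨hzWy, hzD⟩, hzr⟩ := (hev.and_frequently (hfreq r hr)).exists
  have hzW : z ∈ W := by
    have h1 : φ.symm z ∈ φ ⁻¹' W := hrsub ⟨by rwa [mem_ball, dist_zero_right], symm_mem_upperHalfPlaneSet φ hzD⟩
    rw [mem_preimage, φ.apply_symm_apply hzD] at h1
    exact h1
  exact Set.disjoint_left.1 hdisj hzW hzWy

/-- **`Im ψ → 0` at a boundary point other than `b`.** If `φ` has boundary value `D.pt 1` at `∞`,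
`y ∉ D.carrier` and `y ≠ D.pt 1`, then `Im (φ⁻¹ z) → 0` as `z → y` inside `D` (properness of the
homeomorphism `φ : ℍₒ ≃ D` plus boundedness of `ψ` near `y`). -/
theorem tendsto_im_symm_zero (hφ : D.IsChordalUniformizing φ) {y : ℂ} (hyD : y ∉ D.carrier) (hy : y ≠ D.pt 1) :
    Tendsto (fun z => (φ.symm z).im) (𝓝[D.carrier] y) (𝓝 0) := by
  obtain ⟨R, hR⟩ := norm_symm_le_near hφ hy
  rw [Metric.tendsto_nhds]
  intro ε hε
  by_contra hcon
  rw [not_eventually] at hcon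
  -- frequently: `z ∈ D`, `‖ψ z‖ ≤ R`, `Im ψ z ≥ ε`; extract a sequence `zₙ → y` with these properties
  have hfreq : ∃ᶠ z in 𝓝[D.carrier] y, z ∈ D.carrier ∧ ‖φ.symm z‖ ≤ R ∧ ε ≤ (φ.symm z).im := by
    have h1 : ∀ᶠ z in 𝓝[D.carrier] y, z ∈ D.carrier ∧ ‖φ.symm z‖ ≤ R := eventually_mem_nhdsWithin.and hR
    refine (h1.and_frequently hcon).mono fun z ⟨⟨hzD, hzR⟩, hzε⟩ => ⟨hzD, hzR, ?_⟩
    rw [Real.dist_eq, sub_zero, not_lt] at hzε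
    have him : 0 < (φ.symm z).im := symm_mem_upperHalfPlaneSet φ hzD
    rwa [abs_of_pos him] at hzε
  obtain ⟨u, hu_tend, hu⟩ := exists_seq_forall_of_frequently hfreq
  -- `ψ (u n)` lies in the compact `K = closedBall 0 R ∩ {Im ≥ ε} ⊆ ℍₒ`
  set K : Set ℂ := closedBall 0 R ∩ {w | ε ≤ w.im} with hKdef
  have hK : IsCompact K := (isCompact_closedBall 0 R).inter_right (isClosed_le continuous_const Complex.continuous_im)
  have hKH : K ⊆ upperHalfPlaneSet := fun w hw => lt_of_lt_of_le hε hw.2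
  have hmem : ∀ n, φ.symm (u n) ∈ K := fun n =>
    ⟨by rw [mem_closedBall, dist_zero_right]; exact (hu n).2.1, (hu n).2.2⟩
  obtain ⟨w, hwK, s, hs, hlim⟩ := hK.tendsto_subseq hmem
  -- `φ (ψ (u (s n))) = u (s n) → y`, but also `→ φ w ∈ D`
  have hwH : w ∈ upperHalfPlaneSet := hKH hwK
  have hcont : ContinuousWithinAt φ upperHalfPlaneSet w := φ.continuousOn w hwH
  have h1 : Tendsto (fun n => φ (φ.symm (u (s n)))) atTop (𝓝 (φ w)) := by
    refine hcont.tendsto.comp (tendsto_nhdsWithin_iff.2 ⟨hlim, Eventually.of_forall fun n => hKH (hmem (s n))⟩)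
  have h2 : Tendsto (fun n => φ (φ.symm (u (s n)))) atTop (𝓝 y) := by
    have hu' : Tendsto (u ∘ s) atTop (𝓝 y) := (tendsto_nhdsWithin_iff.1 hu_tend).1.comp hs.tendsto_atTop
    refine hu'.congr fun n => ?_
    simp only [Function.comp_apply]
    rw [φ.apply_symm_apply (hu (s n)).1]
  have hyw : y = φ w := tendsto_nhds_unique h2 h1
  exact hyD (hyw ▸ φ.mapsTo hwH)

/-- **Boundary behaviour of chordal uniformizers off the marks** (registered sub-goal
`chordal_symm_boundary_behaviour` of stmt-CriticalPhenomena-11389, line `flip-involution-return-law`; first step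
of input (0) of `stub_touchLawDiag`): at a boundary point `y ∉ D` other than the two marked points,
`ψ = φ⁻¹` is bounded and bounded below near `y` inside `D`, and `Im ψ → 0` there. -/
theorem chordal_symm_boundary_behaviour : ∀ (D : DobrushinDomain) (φ : ConformalEquiv upperHalfPlaneSet D.carrier), D.IsChordalUniformizing φ → ∀ y : ℂ, y ∉ D.carrier → y ≠ D.pt 0 → y ≠ D.pt 1 → (∃ R : ℝ, ∀ᶠ z in 𝓝[D.carrier] y, ‖φ.symm z‖ ≤ R) ∧ (∃ r : ℝ, 0 < r ∧ ∀ᶠ z in 𝓝[D.carrier] y, r ≤ ‖φ.symm z‖) ∧ Tendsto (fun z => (φ.symm z).im) (𝓝[D.carrier] y) (𝓝 0) :=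
  fun _ _ hφ _ hyD hy0 hy1 => ⟨norm_symm_le_near hφ hy1, le_norm_symm_near hφ hy0, tendsto_im_symm_zero hφ hyD hy1⟩

end Summit.CriticalPhenomena.CardyFormulaZ2.Cruxes.ParafermionToSLESixFamilies.FlipInvolutionReturnLaw

end
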